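import Summits.QuantumFields.YangMills.Theorems.BalabanUVNodesN19OtherKindsSpecies
import Literature.MathematicalPhysics.QuantumFieldTheory.Balaban1983to89.T4GaugeActionRate

/-!
# BalabanUVNodes ∕ N19 — SPECIES (γ) AT THE PRINTED FORM OF THE NORMALISATION CONSTANTS ([B16] p. 380 `O(1)·log g_j⁻²·|Z_j|`):
# polynomial-in-`K` losses on the log window are summable, so the constants' centre deviation is a summable window sum WITHOUT a
# `K`-uniform per-operation constant (follow-through of lens row s4″ ∕ v3.0a O4; this seat's `N19OtherKindsSpecies` §D)

Cell `pub-ymgap`, HUMAN RULING D-0062 (Track A), node N19 = NE7, R134 seat dag-n19-c (g4), strategy s1; route `Summits/QuantumFields/YangMills/Theses/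
BalabanUVNodes.lean` rev 15, cluster item K3′ «SpineGivenEndpointR12» (stmt-QuantumFields-19908); filed `--supports` that item `--as helper`.  COUNT-NEUTRAL.

THE LOCATED POINT (numbers, not adjectives).  `N19OtherKindsSpecies.constDev_le_windowSum` prices species (γ)'s centre deviation from a per-operation
input `|cn K t τ i| ≤ Cn·θ′^{scO i}·wO i` with a `K`-UNIFORM constant `Cn`.  The printed form of the constants ([Balaban1989LargeFieldII] CMP 122 p. 380
L13–15: «the corresponding constant O(1)·log g_j⁻² … every large field domain Z_j contributes the constant O(1) log g_j⁻² |Z_j|»; lens v3.0a O4) gives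
instead, per operation `i` at scale `j = scO i` with domain weight `wO i = |Z_j|`: `cn = a·(log g_{j,B} − log g_{j,A})`, `|a| ≤ A·wO i`, hence
`|cn| ≤ A·wO i·|g_{j,B} − g_{j,A}|∕g_min(K, j)` (`log` is `1∕m`-Lipschitz on `[m, ∞)` — the TREE's `T4GaugeActionRate.abs_log_sub_log_le_div`), where
node U2's discrepancy is `|g_{j,B} − g_{j,A}| ≤ Cd·(K+1)^c·θ′^j` (`T4CauchySum.InjectedRate Cd c θ′`) and the UPPER running displayed in the N19 reading
(`1∕g_{K,j}² ≤ 1∕gIR² + β′·(K − j)`) bounds `1∕g_min(K, j) ≤ (1∕gIR + √β′)·(K+1)` — so the honest per-operation constant is `Cn·(K+1)^p`, POLYNOMIAL IN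
`K`, not uniform.  THIS FILE shows the loss is harmless: on the log window `j ≥ jlogOf Cl K` the window sum is `poly(K)·θ′^K`
(`T4GoodClassBudget.summable_windowSum_log`), and `(K+1)^p·windowSum θ′ Λ (jlogOf Cl K) K` is STILL summable for every `θ′ < 1` (§1), so the deviation
datum `(b₀, s)` of (O‴)'s `cO_dev` exists with `s K = Cn·(K+1)^p·Cw·windowSum θ′ Λ (jlogOf Cl K) K` (§2), and the p. 380 form feeds it (§3–§4).
* §1 [folklore] `windowSum_le_pow_mul_windowSum` (rate comparison `windowSum (qθ″) ≤ q^{j⋆}·windowSum θ″`), `succ_pow_mul_pow_logCut_le`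
  (`(K+1)^p·q^{jlogOf C K}` is BOUNDED for `q < 1` — `T4GoodClassBudget.pow_logCut_le` + `N19OtherKindsSpecies.pow_mul_geometric_le_geometric`),
  **`summable_succ_pow_mul_windowSum_log`** (`Σ_K (K+1)^p·windowSum θ Λ (jlogOf C K) K < ∞` for every `0 < θ < 1`, `1 ≤ Λ`, `0 ≤ C`, `p`).
* §2 [folklore] **`constDev_le_windowSum_poly`** — `constDev_le_windowSum` with the per-operation constant `Cn·(K+1)^p`.
* §3 [folklore] `inv_le_succ_mul_of_upperRunning` (`1∕g ≤ (1∕gIR + √β′)·(K+1)` from the displayed upper running), **`constLogRatio_le`** (the p. 380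
  form ⇒ `|cn| ≤ (A·M·Cd)·(K+1)^{1+c}·θ′^j·w`).
* §4 [folklore] **`otherClause_of_species_p380`** — the five (O‴) fields of `N19LedgerLinkSync.LedgerAtSync` for `oA″ = exp α`, `oB″ = exp(Φ+e)·exp β`
  from the species data with (γ) AT THE PRINTED FORM: first-step data `Φ e ρ` (N11 at age K+1), the split `β − α = b₀ K + Σ_{ops} a·(log g_B − log g_A)`,
  `|a| ≤ A·wO`, a coupling floor `m K j` obeying the upper running's consequence `1∕m ≤ M·(K+1)`, node U2's `InjectedRate`-shaped discrepancy — via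
  `N19OtherKindsSpecies.otherClause_of_species` ∘ `constDev_le_windowSum_poly` ∘ `constLogRatio_le`.  NOTHING two-run beyond node U2's coupling
  discrepancy (N17 ∕ U2 by name in any instance) enters.

HONEST FRAMING.  Kernel bookkeeping + elementary real analysis over the tree's shapes; the p. 380 form of the constants, N11's one-run slice bound, node U2's
discrepancy and the running are HYPOTHESES (binders); which operations NODE O's instance books is NODE O's; NE7 ∕ (2.43) ∕ β-matching NOT proved; nothing of
Bałaban's asserted beyond the locators; N19 NOT discharged; Track A count unmoved (5∕27 · A 5∕28).  One finite four-torus at fixed ε, rung (B)+1 — NOT infinite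
volume, NOT OS on ℝ⁴, NOT a mass gap, NOT Clay.  THEOREMS ONLY; 0 `def`; 0 `sorry`; standard axioms.  Edits nothing.
-/

set_option autoImplicit false

noncomputable section

open scoped BigOperators
open Finset MeasureTheory

namespace Summit.QuantumFields.YangMills.BalabanUVNodes.N19ConstantsSpeciesRate

open Literature.MathematicalPhysics.QuantumFieldTheory.Balaban1983to89
open T4RecentScale (Multiplicity)
open T4GoodClassBudget (RecentOnly windowSum jlogOf summable_windowSum_log windowSum_nonneg pow_logCut_le)
open T4GaugeActionRate (abs_log_sub_log_le_div)
open Summit.QuantumFields.YangMills.BalabanUVNodes.N19ConstantsWindow (abs_sum_const_le_windowSum)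
open Summit.QuantumFields.YangMills.BalabanUVNodes.N19OtherKindsSpecies (pow_mul_geometric_le_geometric otherClause_of_species)

/-! ## §1 Polynomial-in-`K` losses on the log window are summable -/

/-- Rate comparison for window sums: for `0 ≤ q ≤ 1`, `0 ≤ θ″`, `0 ≤ Λ`, `windowSum (q·θ″) Λ j⋆ K ≤ q^{j⋆}·windowSum θ″ Λ j⋆ K`. [folklore] -/
theorem windowSum_le_pow_mul_windowSum {q θ'' Λ : ℝ} (hq0 : 0 ≤ q) (hq1 : q ≤ 1) (hθ'' : 0 ≤ θ'') (hΛ : 0 ≤ Λ) (jstar K : ℕ) :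
    windowSum (q * θ'') Λ jstar K ≤ q ^ jstar * windowSum θ'' Λ jstar K := by
  unfold windowSum
  rw [Finset.mul_sum]
  refine Finset.sum_le_sum fun i hi => ?_
  have hi' := (Finset.mem_Icc.mp hi).1
  rw [mul_pow]
  calc q ^ i * θ'' ^ i * Λ ^ (K - i) = q ^ i * (θ'' ^ i * Λ ^ (K - i)) := by ring
    _ ≤ q ^ jstar * (θ'' ^ i * Λ ^ (K - i)) :=
        mul_le_mul_of_nonneg_right (pow_le_pow_of_le_one hq0 hq1 hi') (mul_nonneg (pow_nonneg hθ'' _) (pow_nonneg hΛ _))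

/-- On the log cut a geometric factor absorbs any polynomial: for `0 < q < 1`, `0 ≤ C` and `p : ℕ` there is `B ≥ 0` with
`(K+1)^p·q^{jlogOf C K} ≤ B` for all `K` (`T4GoodClassBudget.pow_logCut_le`: `q^{jlog K} ≤ q^K·q⁻¹·(K+1)^{C log q⁻¹}`, then
`N19OtherKindsSpecies.pow_mul_geometric_le_geometric` at the rate pair `(q, 1)`). [folklore] -/
theorem succ_pow_mul_pow_logCut_le {q C : ℝ} (hq0 : 0 < q) (hq1 : q < 1) (hC : 0 ≤ C) (p : ℕ) :
    ∃ B : ℝ, 0 ≤ B ∧ ∀ K : ℕ, ((K : ℝ) + 1) ^ p * q ^ jlogOf C K ≤ B := by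
  set N : ℕ := ⌈C * Real.log q⁻¹⌉₊ with hN
  obtain ⟨C₀, hC₀, hgeo⟩ := pow_mul_geometric_le_geometric hq0.le hq1 (p + N)
  refine ⟨q⁻¹ * C₀, mul_nonneg (inv_nonneg.mpr hq0.le) hC₀, fun K => ?_⟩
  have hK1 : (1 : ℝ) ≤ (K : ℝ) + 1 := by have := (Nat.cast_nonneg K : (0 : ℝ) ≤ K); linarith
  have hKp : (0 : ℝ) < (K : ℝ) + 1 := by positivity
  have hcut := pow_logCut_le hq0 hq1.le hC K
  have hrpow : ((K : ℝ) + 1) ^ (C * Real.log q⁻¹) ≤ ((K : ℝ) + 1) ^ N := by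
    calc ((K : ℝ) + 1) ^ (C * Real.log q⁻¹) ≤ ((K : ℝ) + 1) ^ ((N : ℕ) : ℝ) :=
          Real.rpow_le_rpow_of_exponent_le hK1 (by rw [hN]; exact Nat.le_ceil _)
      _ = ((K : ℝ) + 1) ^ N := Real.rpow_natCast _ _
  have hg := hgeo K
  rw [one_pow, mul_one] at hg
  calc ((K : ℝ) + 1) ^ p * q ^ jlogOf C K
      ≤ ((K : ℝ) + 1) ^ p * (q ^ K * (q⁻¹ * ((K : ℝ) + 1) ^ (C * Real.log q⁻¹))) :=
        mul_le_mul_of_nonneg_left hcut (by positivity)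
    _ ≤ ((K : ℝ) + 1) ^ p * (q ^ K * (q⁻¹ * ((K : ℝ) + 1) ^ N)) :=
        mul_le_mul_of_nonneg_left (mul_le_mul_of_nonneg_left
          (mul_le_mul_of_nonneg_left hrpow (inv_nonneg.mpr hq0.le)) (pow_nonneg hq0.le K)) (by positivity)
    _ = q⁻¹ * (((K : ℝ) + 1) ^ (p + N) * q ^ K) := by ring
    _ ≤ q⁻¹ * C₀ := mul_le_mul_of_nonneg_left hg (inv_nonneg.mpr hq0.le)

/-- **POLYNOMIAL × LOG-WINDOW SUM IS SUMMABLE** for EVERY rate `θ < 1`: `Σ_K (K+1)^p·windowSum θ Λ (jlogOf C K) K < ∞` (`0 < θ < 1`, `1 ≤ Λ`,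
`0 ≤ C`).  Proof: `θ = q·θ″` with `θ″ = (1+θ)∕2`, `q = θ∕θ″ < 1`; `windowSum θ ≤ q^{jlog K}·windowSum θ″`, `(K+1)^p·q^{jlog K} ≤ B`, and
`T4GoodClassBudget.summable_windowSum_log` at `θ″`. [folklore] -/
theorem summable_succ_pow_mul_windowSum_log {θ Λ C : ℝ} (hθ : 0 < θ) (hθ1 : θ < 1) (hΛ : 1 ≤ Λ) (hC : 0 ≤ C) (p : ℕ) :
    Summable (fun K : ℕ => ((K : ℝ) + 1) ^ p * windowSum θ Λ (jlogOf C K) K) := by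
  set θ'' : ℝ := (1 + θ) / 2 with hθ''
  have hθ''0 : 0 < θ'' := by rw [hθ'']; linarith
  have hθ''1 : θ'' < 1 := by rw [hθ'']; linarith
  have hθθ'' : θ < θ'' := by rw [hθ'']; linarith
  set q : ℝ := θ / θ'' with hq
  have hq0 : 0 < q := div_pos hθ hθ''0
  have hq1 : q < 1 := (div_lt_one hθ''0).mpr hθθ''
  have hθq : θ = q * θ'' := by rw [hq, div_mul_cancel₀ θ hθ''0.ne']
  have hΛ0 : 0 ≤ Λ := le_trans zero_le_one hΛ
  obtain ⟨B, hB, hbd⟩ := succ_pow_mul_pow_logCut_le hq0 hq1 hC p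
  have hmaj : Summable (fun K : ℕ => B * windowSum θ'' Λ (jlogOf C K) K) :=
    (summable_windowSum_log hθ''0 hθ''1 hΛ hC).mul_left B
  refine Summable.of_nonneg_of_le (fun K => mul_nonneg (by positivity) (windowSum_nonneg hθ.le hΛ0 _ _)) (fun K => ?_) hmaj
  calc ((K : ℝ) + 1) ^ p * windowSum θ Λ (jlogOf C K) K
      ≤ ((K : ℝ) + 1) ^ p * (q ^ jlogOf C K * windowSum θ'' Λ (jlogOf C K) K) := by
        rw [hθq]
        exact mul_le_mul_of_nonneg_left (windowSum_le_pow_mul_windowSum hq0.le hq1.le hθ''0.le hΛ0 _ _) (by positivity)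
    _ = (((K : ℝ) + 1) ^ p * q ^ jlogOf C K) * windowSum θ'' Λ (jlogOf C K) K := by ring
    _ ≤ B * windowSum θ'' Λ (jlogOf C K) K := mul_le_mul_of_nonneg_right (hbd K) (windowSum_nonneg hθ''0.le hΛ0 _ _)

/-! ## §2 The constants' centre deviation with a POLYNOMIAL-in-`K` per-operation constant -/

section Window

variable {ι : Type*} {σ : Type*} [DecidableEq σ] {l₀ vol : ℝ} {T : ℕ → Finset σ} {Bad : ℕ → ℝ → Finset σ}

/-- **THE CONSTANTS' CENTRE DEVIATION IS A SUMMABLE WINDOW SUM — POLYNOMIAL CONSTANT** [folklore].  `N19OtherKindsSpecies.constDev_le_windowSum`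
with the per-operation bound `|cn K t τ i| ≤ Cn·(K+1)^p·θ′^{scO i}·wO i` (the honest shape of the [B16] p. 380 constants after §3): the deviation datum
of (O‴)'s `cO_dev` is `c₀ := b₀`, `s K := Cn·(K+1)^p·Cw·windowSum θ′ Λ (jlogOf Cl K) K`, summable by `summable_succ_pow_mul_windowSum_log`.
[cite: Balaban1989LargeFieldII, normalization constants p.380] -/
theorem constDev_le_windowSum_poly {F' : Type*} {ops : ℕ → ℝ → σ → Finset F'} {AllO : ℕ → Finset F'} {scO : F' → ℕ}
    {wO : F' → ℝ} {cn : ℕ → ℝ → σ → F' → ℝ} {Cn θ' Cw Λ Cl : ℝ} {p : ℕ} {α β : ℕ → ℝ → σ → ℝ} {b₀ : ℕ → ℝ}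
    (hsub : ∀ K t, |t| ≤ l₀ → ∀ τ ∈ T K \ Bad K t, ops K t τ ⊆ AllO K) (hw : ∀ K, ∀ i ∈ AllO K, 0 ≤ wO i)
    (hM : ∀ K, Multiplicity (AllO K) scO wO Cw vol Λ K)
    (hrec : ∀ K t, |t| ≤ l₀ → ∀ τ ∈ T K \ Bad K t, RecentOnly (ops K t τ) scO (jlogOf Cl K) K)
    (hcn : ∀ K t, |t| ≤ l₀ → ∀ τ ∈ T K \ Bad K t, ∀ i ∈ ops K t τ,
      |cn K t τ i| ≤ Cn * ((K : ℝ) + 1) ^ p * θ' ^ scO i * wO i)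
    (hCn : 0 ≤ Cn) (hθ0 : 0 < θ') (hθ1 : θ' < 1) (hΛ : 1 ≤ Λ) (hCl : 0 ≤ Cl)
    (hsplit : ∀ K t, |t| ≤ l₀ → ∀ τ ∈ T K \ Bad K t, β K t τ - α K t τ = b₀ K + ∑ i ∈ ops K t τ, cn K t τ i) :
    ∃ c₀ s : ℕ → ℝ, Summable s ∧ ∀ K t, |t| ≤ l₀ → ∀ τ ∈ T K \ Bad K t, |β K t τ - α K t τ - c₀ K| ≤ vol * s K := by
  refine ⟨b₀, fun K => Cn * ((K : ℝ) + 1) ^ p * Cw * windowSum θ' Λ (jlogOf Cl K) K, ?_, fun K t ht τ hτ => ?_⟩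
  · have h := (summable_succ_pow_mul_windowSum_log hθ0 hθ1 hΛ hCl p).mul_left (Cn * Cw)
    refine h.congr fun K => ?_
    ring
  · rw [hsplit K t ht τ hτ, add_sub_cancel_left]
    exact abs_sum_const_le_windowSum (Cr := Cn * ((K : ℝ) + 1) ^ p) (hsub K t ht τ hτ) (hw K) (hM K) (hcn K t ht τ hτ)
      (mul_nonneg hCn (by positivity)) hθ0.le (hrec K t ht τ hτ)

end Window

/-! ## §3 The printed form of the constants feeds §2: log-Lipschitz × node U2's discrepancy × the upper running -/

/-- From the UPPER running displayed in the N19 reading, `1∕g² ≤ 1∕gIR² + β′·(K − j)` with `0 < g`, `0 < gIR`, `0 ≤ β′`, `j ≤ K`: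
`1∕g ≤ (1∕gIR + √β′)·(K + 1)` — the coupling floor costs one power of `K + 1`. [folklore] -/
theorem inv_le_succ_mul_of_upperRunning {g gIR β' : ℝ} {K j : ℕ} (hg : 0 < g) (hgIR : 0 < gIR) (hβ' : 0 ≤ β')
    (hjK : j ≤ K) (hrun : 1 / g ^ 2 ≤ 1 / gIR ^ 2 + β' * ((K : ℝ) - j)) :
    g⁻¹ ≤ (gIR⁻¹ + Real.sqrt β') * ((K : ℝ) + 1) := by
  have hK0 : (0 : ℝ) ≤ (K : ℝ) := Nat.cast_nonneg K
  have hKj : (0 : ℝ) ≤ (K : ℝ) - j := by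
    have : (j : ℝ) ≤ K := by exact_mod_cast hjK
    linarith
  have hKj1 : (K : ℝ) - j ≤ ((K : ℝ) + 1) ^ 2 := by
    have : (j : ℝ) ≥ 0 := Nat.cast_nonneg j
    nlinarith
  -- `g⁻¹ ² ≤ (gIR⁻¹ + √β′·(K+1))²`
  have hsq : g⁻¹ ^ 2 ≤ (gIR⁻¹ + Real.sqrt β' * ((K : ℝ) + 1)) ^ 2 := by
    have h1 : g⁻¹ ^ 2 = 1 / g ^ 2 := by rw [inv_pow, one_div]
    have h2 : gIR⁻¹ ^ 2 = 1 / gIR ^ 2 := by rw [inv_pow, one_div]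
    have hs : Real.sqrt β' ^ 2 = β' := Real.sq_sqrt hβ'
    have hcross : 0 ≤ 2 * gIR⁻¹ * (Real.sqrt β' * ((K : ℝ) + 1)) :=
      mul_nonneg (mul_nonneg zero_le_two (inv_nonneg.mpr hgIR.le)) (mul_nonneg (Real.sqrt_nonneg _) (by linarith))
    calc g⁻¹ ^ 2 = 1 / g ^ 2 := h1
      _ ≤ 1 / gIR ^ 2 + β' * ((K : ℝ) - j) := hrun
      _ ≤ 1 / gIR ^ 2 + β' * ((K : ℝ) + 1) ^ 2 := by nlinarith
      _ = gIR⁻¹ ^ 2 + (Real.sqrt β' * ((K : ℝ) + 1)) ^ 2 := by rw [h2, mul_pow, hs]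
      _ ≤ (gIR⁻¹ + Real.sqrt β' * ((K : ℝ) + 1)) ^ 2 := by nlinarith
  have hR : 0 ≤ gIR⁻¹ + Real.sqrt β' * ((K : ℝ) + 1) :=
    add_nonneg (inv_nonneg.mpr hgIR.le) (mul_nonneg (Real.sqrt_nonneg _) (by linarith))
  have hle : g⁻¹ ≤ gIR⁻¹ + Real.sqrt β' * ((K : ℝ) + 1) := by
    have h := Real.sqrt_le_sqrt hsq
    rwa [Real.sqrt_sq (inv_nonneg.mpr hg.le), Real.sqrt_sq hR] at h
  calc g⁻¹ ≤ gIR⁻¹ + Real.sqrt β' * ((K : ℝ) + 1) := hle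
    _ ≤ gIR⁻¹ * ((K : ℝ) + 1) + Real.sqrt β' * ((K : ℝ) + 1) := by
        have : gIR⁻¹ ≤ gIR⁻¹ * ((K : ℝ) + 1) := le_mul_of_one_le_right (inv_nonneg.mpr hgIR.le) (by linarith)
        linarith
    _ = (gIR⁻¹ + Real.sqrt β') * ((K : ℝ) + 1) := by ring

/-- **THE p. 380 FORM OF ONE OPERATION's CONSTANT LOG-RATIO** [folklore].  If `cn = a·(log g_B − log g_A)` with `|a| ≤ A·w` (the
`O(1)·|Z_j|` prefactor), both couplings lie above a floor `m > 0` with `m⁻¹ ≤ M·(K+1)` (the running, `inv_le_succ_mul_of_upperRunning`), and node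
U2's discrepancy is `|g_B − g_A| ≤ Cd·(K+1)^c·θ′^j` (`InjectedRate` shape), then `|cn| ≤ (A·M·Cd)·(K+1)^{1+c}·θ′^j·w` — the log-Lipschitz step is
the tree's `T4GaugeActionRate.abs_log_sub_log_le_div`. [cite: Balaban1989LargeFieldII, normalization constants O(1) log g_j^{-2} |Z_j| p.380] -/
theorem constLogRatio_le {cn a gA gB m w A M Cd θ' : ℝ} {K c j : ℕ}
    (hcn : cn = a * (Real.log gB - Real.log gA)) (ha : |a| ≤ A * w) (hw : 0 ≤ w) (hA : 0 ≤ A)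
    (hm : 0 < m) (hmA : m ≤ gA) (hmB : m ≤ gB) (hM : m⁻¹ ≤ M * ((K : ℝ) + 1))
    (hθ' : 0 ≤ θ') (hCd : 0 ≤ Cd) (hdisc : |gB - gA| ≤ Cd * ((K : ℝ) + 1) ^ c * θ' ^ j) :
    |cn| ≤ (A * M * Cd) * ((K : ℝ) + 1) ^ (1 + c) * θ' ^ j * w := by
  have hlog : |Real.log gB - Real.log gA| ≤ |gB - gA| / m := abs_log_sub_log_le_div hm hmB hmA
  have hM0 : 0 ≤ M * ((K : ℝ) + 1) := le_trans (inv_nonneg.mpr hm.le) hM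
  have hdisc0 : 0 ≤ Cd * ((K : ℝ) + 1) ^ c * θ' ^ j := by positivity
  have h1 : |Real.log gB - Real.log gA| ≤ (M * ((K : ℝ) + 1)) * (Cd * ((K : ℝ) + 1) ^ c * θ' ^ j) := by
    calc |Real.log gB - Real.log gA| ≤ |gB - gA| / m := hlog
      _ = m⁻¹ * |gB - gA| := by rw [div_eq_inv_mul]
      _ ≤ (M * ((K : ℝ) + 1)) * (Cd * ((K : ℝ) + 1) ^ c * θ' ^ j) :=
          mul_le_mul hM hdisc (abs_nonneg _) hM0
  rw [hcn, abs_mul]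
  calc |a| * |Real.log gB - Real.log gA|
      ≤ (A * w) * ((M * ((K : ℝ) + 1)) * (Cd * ((K : ℝ) + 1) ^ c * θ' ^ j)) :=
        mul_le_mul ha h1 (abs_nonneg _) (mul_nonneg hA hw)
    _ = (A * M * Cd) * ((K : ℝ) + 1) ^ (1 + c) * θ' ^ j * w := by ring

/-! ## §4 (O‴) from the species data with (γ) at the printed form -/

section Assembly

variable {ι : Type*} {σ : Type*} [DecidableEq σ] {dom : Set ι} {l₀ vol : ℝ} {T : ℕ → Finset σ} {Bad : ℕ → ℝ → Finset σ}

/-- **(O‴) FROM THE SPECIES DATA, THE NORMALISATION CONSTANTS AT [B16] p. 380's FORM** [folklore].  Species (α) as in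
`N19OtherKindsSpecies.otherClause_of_species` (`Φ e ρ`, ONE-RUN `|Φ| ≤ vol·ρ K`, `Summable ρ`); species (γ): on every good term the two runs' constant
log-ratio splits as `β − α = b₀ K + Σ_{i ∈ ops K t τ} a K t τ i·(log (gB K (scO i)) − log (gA K (scO i)))` over a RECENT-ONLY set of operations
`ops K t τ ⊆ AllO K` with weights `wO ≥ 0`, full-torus `Multiplicity`, prefactors `|a K t τ i| ≤ A·wO i`, both runs' couplings above a floor
`m K j > 0` (`j ≤ K`) whose inverse grows at most like `M·(K+1)` (the upper running), and node U2's discrepancy `|gB K j − gA K j| ≤ Cd·(K+1)^c·θ′^j` for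
`j ≤ K` (`T4CauchySum.InjectedRate Cd c θ′` verbatim; `0 < θ′ < 1`) — all read at the operations' scales `scO i ≤ K` (`RecentOnly`).
CONCLUSION: the five (O‴) fields `posO ∧ other ∧ RO_le ∧ rO_summable ∧ cO_dev` for `oA″ = exp α`, `oB″ = exp(Φ + e)·exp β`, centre `e K + (β − α)`,
radius `vol·ρ K`, profile `ρ` — `otherClause_of_species` ∘ `constDev_le_windowSum_poly` ∘ `constLogRatio_le`.  Nothing two-run enters except node
U2's coupling discrepancy (N17 ∕ U2 by name in any instance). -/
theorem otherClause_of_species_p380 {F' : Type*} {oA oB Φ : ℕ → ℝ → σ → ι → ℝ} {e ρ : ℕ → ℝ} {α β : ℕ → ℝ → σ → ℝ}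
    {ops : ℕ → ℝ → σ → Finset F'} {AllO : ℕ → Finset F'} {scO : F' → ℕ} {wO : F' → ℝ} {a : ℕ → ℝ → σ → F' → ℝ}
    {gA gB m : ℕ → ℕ → ℝ} {A M Cd θ' Cw Λ Cl : ℝ} {c : ℕ} {b₀ : ℕ → ℝ}
    (hoA : ∀ K t τ v, oA K t τ v = Real.exp (α K t τ))
    (hoB : ∀ K t τ v, oB K t τ v = Real.exp (Φ K t τ v + e K) * Real.exp (β K t τ))
    (hΦ : ∀ K t, |t| ≤ l₀ → ∀ τ ∈ T K \ Bad K t, ∀ v ∈ dom, |Φ K t τ v| ≤ vol * ρ K) (hρ : Summable ρ)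
    (hsub : ∀ K t, |t| ≤ l₀ → ∀ τ ∈ T K \ Bad K t, ops K t τ ⊆ AllO K) (hw : ∀ K, ∀ i ∈ AllO K, 0 ≤ wO i)
    (hMu : ∀ K, Multiplicity (AllO K) scO wO Cw vol Λ K)
    (hrec : ∀ K t, |t| ≤ l₀ → ∀ τ ∈ T K \ Bad K t, RecentOnly (ops K t τ) scO (jlogOf Cl K) K)
    (hsplit : ∀ K t, |t| ≤ l₀ → ∀ τ ∈ T K \ Bad K t,
      β K t τ - α K t τ = b₀ K + ∑ i ∈ ops K t τ, a K t τ i * (Real.log (gB K (scO i)) - Real.log (gA K (scO i))))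
    (ha : ∀ K t, |t| ≤ l₀ → ∀ τ ∈ T K \ Bad K t, ∀ i ∈ ops K t τ, |a K t τ i| ≤ A * wO i) (hA : 0 ≤ A)
    (hm : ∀ K j, j ≤ K → 0 < m K j) (hmA : ∀ K j, j ≤ K → m K j ≤ gA K j) (hmB : ∀ K j, j ≤ K → m K j ≤ gB K j)
    (hM : ∀ K j, j ≤ K → (m K j)⁻¹ ≤ M * ((K : ℝ) + 1))
    (hCd : 0 ≤ Cd) (hdisc : ∀ K j, j ≤ K → |gB K j - gA K j| ≤ Cd * ((K : ℝ) + 1) ^ c * θ' ^ j)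
    (hθ0 : 0 < θ') (hθ1 : θ' < 1) (hΛ : 1 ≤ Λ) (hCl : 0 ≤ Cl) :
    (∀ K t, |t| ≤ l₀ → ∀ τ ∈ T K \ Bad K t, ∀ v ∈ dom, 0 < oA K t τ v ∧ 0 < oB K t τ v) ∧
    (∀ K t, |t| ≤ l₀ → ∀ τ ∈ T K \ Bad K t, ∀ v ∈ dom,
        |Real.log (oB K t τ v) - Real.log (oA K t τ v) - (e K + (β K t τ - α K t τ))| ≤ vol * ρ K) ∧
    (∀ K t, |t| ≤ l₀ → ∀ τ ∈ T K \ Bad K t, vol * ρ K ≤ vol * ρ K) ∧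
    Summable ρ ∧
    (∃ c₀ s : ℕ → ℝ, Summable s ∧ ∀ K t, |t| ≤ l₀ → ∀ τ ∈ T K \ Bad K t,
        |e K + (β K t τ - α K t τ) - c₀ K| ≤ vol * s K) := by
  have hM0 : 0 ≤ M := by
    have h := (inv_nonneg.mpr (hm 0 0 le_rfl).le).trans (hM 0 0 le_rfl)
    simpa using h
  refine otherClause_of_species (dom := dom) hoA hoB hΦ hρ
    (constDev_le_windowSum_poly (vol := vol) (p := 1 + c) (Cn := A * M * Cd)
      (cn := fun K t τ i => a K t τ i * (Real.log (gB K (scO i)) - Real.log (gA K (scO i))))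
      hsub hw hMu hrec (fun K t ht τ hτ i hi => ?_) (by positivity) hθ0 hθ1 hΛ hCl hsplit)
  -- the operation is recent, in particular its scale is `≤ K`, where the floor, the running and U2's discrepancy are read
  have hjK : scO i ≤ K := ((hrec K t ht τ hτ) i hi).2
  exact constLogRatio_le rfl (ha K t ht τ hτ i hi) (hw K i (hsub K t ht τ hτ hi)) hA (hm K (scO i) hjK) (hmA K (scO i) hjK)
    (hmB K (scO i) hjK) (hM K (scO i) hjK) hθ0.le hCd (hdisc K (scO i) hjK)

end Assembly

end Summit.QuantumFields.YangMills.BalabanUVNodes.N19ConstantsSpeciesRate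

end
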